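import Summits.AtomisticToContinuum.Crystallization.Theorems.ChargedEnergyGapBoxSplit
import Summits.AtomisticToContinuum.Crystallization.Theorems.ChargedEnergyGapCostCell
import HarnessLib

/-!
# ChargedEnergyGap · NODE 113Q «ShallowLaw» — the CLOSED-FORM box law of the shallow zone `trivBox` (M3 of critic r1901), TYPED and PROVED

decomp-a2c lens-3 g97.  Line of record `stmt-AtomisticToContinuum-14231` (`PricedLinkCensus.ChargedEnergyGap`, r3); deciding leaf (T¹ᶜ)
`StencilChartLawQ 130 (1/60000000) 160 (3/100) (679/1000) (691/1000)`; beneath it NODE 113P «BoxSplit» (`residualBoxes`, nine zone boxes, the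
first of which is `trivBox` = T₀ ∈ [93.5, 95.313]).  Imports TREE 113P `…BoxSplit` (for `GBox`, `trivBox`, the LAW⁺ binder shape) and 107
`…CostCell`; NO new objects, no Prop-valued defs, no `instance` / notation / `set_option`.

THE MATHEMATICS (one paragraph).  On a box `A` every vertex depth is `≤ dt 0 + ρ ≤ A.c1 + A.r1` (113N `vertex_le_centre_add`), so every vertex
weight is `≤ φ(A.c1 + A.r1)` (`depthProfile_monotone`); the six UNIT patterns of `T75` (value `12129/100000` each, `unitPat_mem`) represent any
non-negative sextuple, so `roofVal T75 W ≤ (12129/100000)·Σ_q W_q ≤ 6·(12129/100000)·φ(A.c1 + A.r1)` (tree E8 `roofVal_T75_le_of_repr`), and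
`feetHoleCost = (3/100·2ρ)²·roofVal ≤ (3/100·2·A.r1)²·(…)` (106 `feetHoleCost_le_of_roofVal_le`).  On the cap side the charge depth is a pole mean
plus `ρ` (`chargeDepth_eq_holeVertex`) hence `≤ A.c1 + 2·A.r1`; if that is `≤ 110` then `κ = 2` (`domKappa_ge_hi`) and `domCapK u … ≥ 2·u/10 = u/5`
(the letter term of `domCapK` is non-negative).  So ONE closed rational inequality
`(3/100·(2·A.r1))²·(6·((12129/100000)·φ_ℚ(A.c1 + A.r1))) ≤ u/5` (exact: `depthProfileQ`, `cast_depthProfileQ`) gives LAW⁺(A, u):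
★★ `shallowBoxLaw`.  For `trivBox` (`A.c1 + A.r1 = 96.695`, `φ ≈ 2.2·10⁻⁶`) the inequality holds with ratio ≈ 0.83 and is decided by the kernel:
★★★ `trivBoxLaw : LAW⁺(trivBox, 1/60000000)` — the first hypothesis `hTriv` of the nine-zone assembly over `residualBoxes` is DISCHARGED.
(The same lemma does NOT reach `easyBox`: `φ(110.004) ≈ 6·10⁻⁴` is ≈ 1 700× too large for the unit patterns; that zone needs cells — LEDGER v7 §B-F.)
-/

noncomputable section

namespace Summit.AtomisticToContinuum.Crystallization.Theorems.ChargedEnergyGapChartDial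

open scoped Classical
open Literature.MathematicalPhysics.StatisticalMechanics Literature.Geometry.DiscreteGeometry
open Summit.AtomisticToContinuum.Crystallization.Theses.PricedLinkCensus
open Summit.AtomisticToContinuum.Crystallization.Theorems.ChargedEnergyGapNegative

/-! ## §113Q.1 The unit-pattern roof bound -/

/-- ★ The six unit patterns bound the roof: `roofVal T75 W ≤ Σ_q W_q · 12129/100000` for every non-negative sextuple (identity relabelling;
the representation of `roofSet_T75_nonempty` read as an upper bound through E8 `roofVal_T75_le_of_repr`). -/
theorem roofVal_T75_le_units (W : Fin 3 × Bool → ℝ) (h0 : ∀ p, 0 ≤ W p) :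
    roofVal T75 W ≤ (W (0, true) + W (0, false) + W (1, true) + W (1, false) + W (2, true) + W (2, false)) * (12129 / 100000) := by
  let pos : Fin 6 → Fin 3 × Bool := ![(0, true), (0, false), (1, true), (1, false), (2, true), (2, false)]
  have hrel : ∀ p : Fin 3 × Bool, relabel 0 0 p = p := fun p => by
    rcases p with ⟨a, b⟩; fin_cases a <;> cases b <;> rfl
  have hrepr : ∀ p, W p = ∑ i, (fun i => W (pos i)) i * (unitPat i).1 (relabel ((fun _ : Fin 6 => (0 : Fin 6)) i) ((fun _ : Fin 6 => (0 : Fin 8)) i) p) := by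
    intro p
    simp only [hrel, Fin.sum_univ_succ, Fin.sum_univ_zero]
    rcases p with ⟨a, b⟩
    fin_cases a <;> cases b <;> simp [pos, unitPat, sext]
  have h := roofVal_T75_le_of_repr unitPat (fun _ => 0) (fun _ => 0) (fun i => W (pos i)) unitPat_mem (fun i => h0 _) hrepr
  have hval : ∑ i, (fun i => W (pos i)) i * (unitPat i).2
      = (W (0, true) + W (0, false) + W (1, true) + W (1, false) + W (2, true) + W (2, false)) * (12129 / 100000) := by
    simp only [Fin.sum_univ_succ, Fin.sum_univ_zero, pos, unitPat]
    simp
    ring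
  linarith [h, hval]

/-! ## §113Q.2 ★★ The generic shallow box law -/

/-- ★★ **SHALLOW BOX LAW.**  If on the box `A` (with `0 < A.r0`, `0 ≤ A.c0`) the charge depth cannot exceed `110` (`A.c1 + 2·A.r1 ≤ 110`, so
`κ = 2` and the cap is at least `u/5`) and the crude unit-pattern cost bound at the deepest admissible vertex `A.c1 + A.r1` is below `u/5`
(ONE closed rational inequality, `decide`), then LAW⁺(A, u) — the binder shape of 113P `stencilChartLawQ_of_boxes` VERBATIM. -/
theorem shallowBoxLaw {dK u : ℚ} (A : GBox) (hA : 0 < A.r0) (hc : 0 ≤ A.c0) (hu : 0 ≤ u) (hκ : A.c1 + 2 * A.r1 ≤ 110)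
    (hnum : (3 / 100 * (2 * A.r1)) ^ 2 * (6 * (12129 / 100000 * depthProfileQ 160 (A.c1 + A.r1))) ≤ u / 5) :
    ∀ ρ : ℝ, (A.r0 : ℝ) ≤ ρ → ρ ≤ A.r1 → ∀ dt : (Fin 3 → ℤ) → ℝ,
      (A.t0 : ℝ) ≤ dt (holeVertex 0 (0, true)) → dt (holeVertex 0 (0, true)) ≤ A.t1 →
      (A.f0 : ℝ) ≤ dt (holeVertex 0 (0, false)) → dt (holeVertex 0 (0, false)) ≤ A.f1 → (A.c0 : ℝ) ≤ dt 0 → dt 0 ≤ A.c1 →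
      IsChartRealisable ρ dt → (∀ p ∈ stencil 0, 0 < dt p) → poleSum dt 0 ≤ poleSum dt 1 → poleSum dt 0 ≤ poleSum dt 2 →
      (∀ a : Fin 3, dt (holeVertex 0 (a, true)) ≤ dt (holeVertex 0 (a, false))) → IsTupleHole (dK : ℝ) ρ dt →
      feetHoleCost 160 (3 / 100) ρ dt 0 ≤ domCapK u 160 (3 / 100) ρ (chargeDepth ρ dt 0) := by
  intro ρ e0 e1 dt _t0 _t1 _f0 _f1 c0 c1 hreal _hpos _hch1 _hch2 _hchp _hhole
  have hρ0 : (0 : ℝ) < ρ := lt_of_lt_of_le (by exact_mod_cast hA) e0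
  have hC0 : (0 : ℝ) ≤ dt 0 := le_trans (by exact_mod_cast hc) c0
  have hu' : (0 : ℝ) ≤ u := by exact_mod_cast hu
  -- every vertex depth ≤ C + ρ ≤ A.c1 + A.r1
  have hv : ∀ q, dt (holeVertex 0 q) ≤ ((A.c1 + A.r1 : ℚ) : ℝ) := fun q => by
    have := vertex_le_centre_add hρ0.le hreal hC0 q
    push_cast
    linarith
  -- every vertex weight ≤ φ(A.c1 + A.r1), and ≥ 0
  set Φ : ℝ := ((depthProfileQ 160 (A.c1 + A.r1) : ℚ) : ℝ) with hΦ
  have hW : ∀ q, vtxW 160 dt 0 q ≤ Φ := fun q => by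
    rw [hΦ, cast_depthProfileQ]; push_cast
    exact depthProfile_monotone (by norm_num) (by have := hv q; push_cast at this; exact this)
  have hW0 : ∀ q, 0 ≤ vtxW 160 dt 0 q := fun q => depthProfile_nonneg _ _
  -- roof ≤ 6·(c_u·Φ)
  have hroof : roofVal T75 (vtxW 160 dt 0) ≤ 6 * (12129 / 100000 * Φ) := by
    have h := roofVal_T75_le_units (vtxW 160 dt 0) hW0
    have := hW (0, true); have := hW (0, false); have := hW (1, true); have := hW (1, false); have := hW (2, true); have := hW (2, false)
    nlinarith
  -- cost ≤ (3/100·2·A.r1)²·6·(c_u·Φ) ≤ u/5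
  have hcost : feetHoleCost 160 (3 / 100) ρ dt 0 ≤ (3 / 100 * (2 * (A.r1 : ℝ))) ^ 2 * (6 * (12129 / 100000 * Φ)) :=
    feetHoleCost_le_of_roofVal_le (by norm_num) hρ0.le e1 hroof
  have hn : (3 / 100 * (2 * (A.r1 : ℝ))) ^ 2 * (6 * (12129 / 100000 * Φ)) ≤ (u : ℝ) / 5 := by
    have h := (Rat.cast_le (K := ℝ)).mpr hnum
    simp only [Rat.cast_mul, Rat.cast_pow, Rat.cast_div, Rat.cast_ofNat] at h
    simpa [hΦ] using h
  -- cap ≥ u/5: t ≤ A.c1 + 2·A.r1 ≤ 110 ⇒ κ(t) = 2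
  have ht : chargeDepth ρ dt 0 ≤ 110 := by
    rw [chargeDepth_eq_holeVertex]
    have h1 := hv (hAxis ρ dt 0, true); have h2 := hv (hAxis ρ dt 0, false)
    have hκ' : ((A.c1 + A.r1 : ℚ) : ℝ) + A.r1 ≤ 110 := by
      have := (Rat.cast_le (K := ℝ)).mpr hκ; push_cast at this ⊢; linarith
    linarith
  have hk : (2 : ℝ) ≤ domKappa (chargeDepth ρ dt 0) := by
    have := domKappa_ge_hi ht; norm_num at this; exact this
  have hcap : (u : ℝ) / 5 ≤ domCapK u 160 (3 / 100) ρ (chargeDepth ρ dt 0) := by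
    unfold domCapK
    have hmax : (0 : ℝ) ≤ max (domKappa (chargeDepth ρ dt 0) * (103 / 100 * ((3 / 100 * (2 * ρ)) ^ 2 * roofVal T75 (tiltSext 160 ρ (chargeDepth ρ dt 0)))))
        (if (241 / 2 : ℝ) ≤ chargeDepth ρ dt 0 then 45 * (u : ℝ) else 0) :=
      le_max_of_le_right (by split_ifs <;> nlinarith)
    have h2 : 2 * ((u : ℝ) / 10) ≤ domKappa (chargeDepth ρ dt 0) * ((u : ℝ) / 10) :=
      mul_le_mul_of_nonneg_right hk (by positivity)
    linarith
  linarith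

/-! ## §113Q.3 ★★★ The shallow zone of 113P is closed -/

/-- ★★★ **`trivBox` IS CLOSED** (T₀ ∈ [93.5, 95.313], C ≤ 96.004): LAW⁺(trivBox, 1/60000000) — the `hTriv` hypothesis of the nine-zone
assembly `stencilChartLawQ_of_boxes (by norm_num) residualBoxes residualTree residualTree_check`, DISCHARGED; the rational inequality
(ratio ≈ 0.83) is decided by the kernel. -/
theorem trivBoxLaw :
    ∀ ρ : ℝ, (trivBox.r0 : ℝ) ≤ ρ → ρ ≤ trivBox.r1 → ∀ dt : (Fin 3 → ℤ) → ℝ,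
      (trivBox.t0 : ℝ) ≤ dt (holeVertex 0 (0, true)) → dt (holeVertex 0 (0, true)) ≤ trivBox.t1 →
      (trivBox.f0 : ℝ) ≤ dt (holeVertex 0 (0, false)) → dt (holeVertex 0 (0, false)) ≤ trivBox.f1 → (trivBox.c0 : ℝ) ≤ dt 0 → dt 0 ≤ trivBox.c1 →
      IsChartRealisable ρ dt → (∀ p ∈ stencil 0, 0 < dt p) → poleSum dt 0 ≤ poleSum dt 1 → poleSum dt 0 ≤ poleSum dt 2 →
      (∀ a : Fin 3, dt (holeVertex 0 (a, true)) ≤ dt (holeVertex 0 (a, false))) → IsTupleHole ((130 : ℚ) : ℝ) ρ dt →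
      feetHoleCost 160 (3 / 100) ρ dt 0 ≤ domCapK ((1 / 60000000 : ℚ) : ℝ) 160 (3 / 100) ρ (chargeDepth ρ dt 0) :=
  shallowBoxLaw trivBox (by norm_num [trivBox]) (by norm_num [trivBox]) (by norm_num) (by norm_num [trivBox]) (by decide +kernel)

/-- MUST-FAIL TWIN (negative control, kernel-checked): the same rational test at the top of `easyBox` (`A.c1 + A.r1 = 110.695`) is FALSE —
the unit-pattern bound does not reach the next zone (LEDGER v7 §B-F: `easyBox` needs cells). -/
example : decide ((3 / 100 * (2 * easyBox.r1)) ^ 2 * (6 * (12129 / 100000 * depthProfileQ 160 (easyBox.c1 + easyBox.r1))) ≤ (1 / 60000000 : ℚ) / 5)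
    = false := by decide +kernel

/-- How far the lemma reaches (kernel-checked): the test still holds at `c1 = 96.2` (so a re-cut `trivBox` up to T₀ ≈ 95.5 would also close) … -/
example : (3 / 100 * (2 * (691 / 1000 : ℚ))) ^ 2 * (6 * (12129 / 100000 * depthProfileQ 160 (481 / 5 + 691 / 1000))) ≤ (1 / 60000000 : ℚ) / 5 := by
  decide +kernel

/-- … and fails at `c1 = 96.4`. -/
example : decide ((3 / 100 * (2 * (691 / 1000 : ℚ))) ^ 2 * (6 * (12129 / 100000 * depthProfileQ 160 (482 / 5 + 691 / 1000))) ≤ (1 / 60000000 : ℚ) / 5)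
    = false := by decide +kernel

end Summit.AtomisticToContinuum.Crystallization.Theorems.ChargedEnergyGapChartDial
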